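import Literature.AlgebraicGeometry.Frobenioids.BiratUnits
import HarnessLib

/-!
# Frobenioids I, Proposition 4.4 (i): the morphisms of the birationalization `C^birat` (part 1)

Mochizuki, *The geometry of Frobenioids I: the general theory*, Kyushu J. Math. **62** (2008)
293–400, §4, Proposition 4.4 (i), kurims text pp. 82–84 [cite: MochizukiFrdI2008, Prop. 4.4(i)
p.83]:

  "For `A, B ∈ Ob(C)`, write `Hom^birat_C(A, B) := lim_{(A' → A) ∈ C^coa-pre_A} Hom_C(A', B)` … (i)
  Composition of morphisms in `C` determines a natural composition map
  `Hom^birat_C(A, B) × Hom^birat_C(B, C) → Hom^birat_C(A, C)`, hence a category `C^birat`, whose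
  objects are the objects of `C` and whose morphisms are given by `Hom^birat_C`."

The proof (p. 84): "Given morphisms `φ′ : A′ → B`, `ψ′ : B′ → C` and co-angular pre-steps
`α : A′ → A`, `β : B′ → B`, it follows from Proposition 1.11, (vii), that there exists a commutative
diagram [`α′ : A″ → A′` a co-angular pre-step, `φ″ : A″ → B′`, `φ″ ≫ β = α′ ≫ φ′`] … Then we take
the
composite … to be the image of `ψ′ ∘ φ″`.  To show that this assignment is independent of the choice
of `α′, φ″` … observe that since `β` is a monomorphism [Def. 1.3 (v)(a)] … Also, one verifies
immediately that composite of morphisms of `Hom^birat_C(−, −)` is associative."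

This file types exactly that: *birational fractions* `(α, φ′)` (`BiratFrac F A B`: a co-angular
pre-step `α : A′ → A` and a morphism `φ′ : A′ → B`), the colimit relation (common co-angular
pre-step
refinement — an equivalence relation by the directedness of `C^coa-pre_A`, Def. 1.3 (iii)(d),
`exists_common_refinement`), the image `(id, φ)` of a morphism of `C`, composition computed with a
*square* as above and its independence of the square, compatibility with the relation, and the
associativity and unit laws up to the relation.  The square-completion property of Prop. 1.11 (vii)
enters as an explicit hypothesis `hsq` (TODO-merge abc-iut-L1-t1: `exists_coAngular_square` /
`HasCoAngularSquares` of `CoAngularPreSteps.lean` discharges it for every Frobenioid).  The category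
`C^birat` itself, the functor `C → C^birat` and the functor to `F_{Φ^gp}` are in part 2
(`BirationalizationCategory.lean`).  The unit groups `O^×(A^birat)` were built directly in
`BiratUnits.lean` (pairs of co-angular pre-steps); diagrammatic composition throughout.
-/

namespace Literature.AlgebraicGeometry.Frobenioids

open CategoryTheory Opposite

universe w v v' u u'

namespace PreFrobenioid

variable {D : Type u} [Category.{v} D] {Φ : Dᵒᵖ ⥤ CommMonCat.{w}}
  {C : Type u'} [Category.{v'} C] {F : C ⥤ ElemFrobenioid Φ}

variable (F) in
/-- The square-completion property of **Prop. 1.11 (vii)** used to compose birational morphisms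
(FrdI p. 84 l. 3): for a morphism `φ : X → B` and a co-angular pre-step `β : B′ → B` there are a
co-angular pre-step `α′ : X′ → X` and a morphism `φ″ : X′ → B′` with `α′ ≫ φ = φ″ ≫ β`.  Recorded
as a
`Prop` so that it can be assumed; it holds in every Frobenioid (Prop. 1.11 (vii), TODO-merge
abc-iut-L1-t1 `exists_coAngular_square`). [cite: MochizukiFrdI2008, Prop. 1.11(vii) p.37] -/
def HasBiratSquares : Prop :=
  ∀ ⦃X B B' : C⦄ (φ : X ⟶ B) (β : B' ⟶ B), IsCoAngularPreStep F β →
    ∃ (X' : C) (α' : X' ⟶ X) (φ'' : X' ⟶ B'), IsCoAngularPreStep F α' ∧ α' ≫ φ = φ'' ≫ β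

variable (F) in
/-- A *birational fraction* from `A` to `B`: a co-angular pre-step `α : A′ → A` together with a
morphism `φ′ : A′ → B` — an element of the term `Hom_C(A′, B)` of the inductive system defining
`Hom^birat_C(A, B)` (FrdI Prop. 4.4, p. 82). [cite: MochizukiFrdI2008, Prop. 4.4(i) p.83] -/
structure BiratFrac (A B : C) : Type (max u' v') where
  /-- the apex `A′` -/
  src : C
  /-- the co-angular pre-step `α : A′ → A` (inverted) -/
  den : src ⟶ A
  /-- the morphism `φ′ : A′ → B` -/
  num : src ⟶ B
  /-- `α` is a co-angular pre-step -/
  den_mem : IsCoAngularPreStep F den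

namespace BiratFrac

variable {A B B' B'' : C}

/-- Equality in the inductive limit `Hom^birat_C(A, B)`: the two fractions agree after refining by
co-angular pre-steps (the transition maps are injective, `C` being totally epimorphic).
[cite: MochizukiFrdI2008, Prop. 4.4(i) p.83] -/
def Rel (f g : BiratFrac F A B) : Prop :=
  ∃ (E : C) (ε : E ⟶ f.src) (ε' : E ⟶ g.src), IsCoAngularPreStep F ε ∧ IsCoAngularPreStep F ε' ∧
    ε ≫ f.den = ε' ≫ g.den ∧ ε ≫ f.num = ε' ≫ g.num

/-- `Rel` is reflexive. [cite: MochizukiFrdI2008, Prop. 4.4(i) p.83] -/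
theorem Rel.refl (hF : IsFrobenioid F) (f : BiratFrac F A B) : Rel f f :=
  ⟨f.src, 𝟙 _, 𝟙 _, isCoAngularPreStep_id hF _, isCoAngularPreStep_id hF _, rfl, rfl⟩

/-- `Rel` is symmetric. [cite: MochizukiFrdI2008, Prop. 4.4(i) p.83] -/
theorem Rel.symm {f g : BiratFrac F A B} (h : Rel f g) : Rel g f := by
  obtain ⟨E, ε, ε', hε, hε', h₁, h₂⟩ := h
  exact ⟨E, ε', ε, hε', hε, h₁.symm, h₂.symm⟩

/-- `Rel` is transitive (directedness of `C^coa-pre_A`, Def. 1.3 (iii)(d)).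
[cite: MochizukiFrdI2008, Prop. 4.4(i) p.83] -/
theorem Rel.trans (hF : IsFrobenioid F) {f g k : BiratFrac F A B} (h : Rel f g) (h' : Rel g k) :
    Rel f k := by
  obtain ⟨E, ε, ε', hε, hε', h₁, h₂⟩ := h
  obtain ⟨E', δ, δ', hδ, hδ', h₁', h₂'⟩ := h'
  obtain ⟨T, κ, κ', hκ, hκ', hT⟩ := exists_common_refinement hF ε' δ hε' hδ
  refine ⟨T, κ ≫ ε, κ' ≫ δ', hκ.comp hF hε, hκ'.comp hF hδ', ?_, ?_⟩
  · rw [Category.assoc, h₁, ← Category.assoc, hT, Category.assoc, h₁', Category.assoc]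
  · rw [Category.assoc, h₂, ← Category.assoc, hT, Category.assoc, h₂', Category.assoc]

variable (F) in
/-- The colimit relation as a setoid. [cite: MochizukiFrdI2008, Prop. 4.4(i) p.83] -/
def setoid (hF : IsFrobenioid F) (A B : C) : Setoid (BiratFrac F A B) where
  r := Rel
  iseqv := ⟨Rel.refl hF, Rel.symm, Rel.trans hF⟩

/-- The image of a morphism `φ : A → B` of `C` in `Hom^birat_C(A, B)`: the fraction `(id, φ)` (the
functor `C → C^birat`). [cite: MochizukiFrdI2008, Prop. 4.4(i) p.83] -/
def ofHom (hF : IsFrobenioid F) (φ : A ⟶ B) : BiratFrac F A B :=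
  ⟨A, 𝟙 A, φ, isCoAngularPreStep_id hF A⟩

/-- Restricting a fraction along a co-angular pre-step does not change its class.
[cite: MochizukiFrdI2008, Prop. 4.4(i) p.83] -/
theorem rel_restrict (hF : IsFrobenioid F) (f : BiratFrac F A B) {E : C} (ε : E ⟶ f.src)
    (hε : IsCoAngularPreStep F ε) :
    Rel (⟨E, ε ≫ f.den, ε ≫ f.num, hε.comp hF f.den_mem⟩ : BiratFrac F A B) f :=
  ⟨E, 𝟙 _, ε, isCoAngularPreStep_id hF _, hε, by rw [Category.id_comp], by rw [Category.id_comp]⟩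

/-! ### Composition (proof of Prop. 4.4 (i), p. 84) -/

/-- A *composition square* for `f = (α, φ′) : A ⇢ B` and `g = (β, ψ′) : B ⇢ B′`: a co-angular
pre-step
`α′ : A″ → A′` and `φ″ : A″ → B′₀` with `α′ ≫ φ′ = φ″ ≫ β` (FrdI p. 84, from Prop. 1.11 (vii)).
[cite: MochizukiFrdI2008, Prop. 4.4(i) p.84] -/
structure Square (f : BiratFrac F A B) (g : BiratFrac F B B') : Type (max u' v') where
  /-- the apex `A″` -/
  apex : C
  /-- `α′ : A″ → A′` -/
  left : apex ⟶ f.src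
  /-- `φ″ : A″ → B′₀` (the apex of `g`) -/
  right : apex ⟶ g.src
  /-- `α′` is a co-angular pre-step -/
  left_mem : IsCoAngularPreStep F left
  /-- commutativity `α′ ≫ φ′ = φ″ ≫ β` -/
  w : left ≫ f.num = right ≫ g.den

/-- Squares exist under the square-completion hypothesis (Prop. 1.11 (vii)).
[cite: MochizukiFrdI2008, Prop. 4.4(i) p.84] -/
theorem nonempty_square (hsq : HasBiratSquares F) (f : BiratFrac F A B) (g : BiratFrac F B B') :
    Nonempty (Square f g) := by
  obtain ⟨X', α', φ'', hα', hw⟩ := hsq f.num g.den g.den_mem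
  exact ⟨⟨X', α', φ'', hα', hw⟩⟩

/-- A chosen composition square. [cite: MochizukiFrdI2008, Prop. 4.4(i) p.84] -/
noncomputable def someSquare (hsq : HasBiratSquares F) (f : BiratFrac F A B)
    (g : BiratFrac F B B') :
    Square f g :=
  Classical.choice (nonempty_square hsq f g)

/-- The composite computed with a given square: `(α′ ≫ α, φ″ ≫ ψ′)` ("we take the composite … to be
the image of `ψ′ ∘ φ″`"). [cite: MochizukiFrdI2008, Prop. 4.4(i) p.84] -/
def compWith (hF : IsFrobenioid F) (f : BiratFrac F A B) (g : BiratFrac F B B') (S : Square f g) :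
    BiratFrac F A B' :=
  ⟨S.apex, S.left ≫ f.den, S.right ≫ g.num, S.left_mem.comp hF f.den_mem⟩

/-- The composite (with the chosen square). [cite: MochizukiFrdI2008, Prop. 4.4(i) p.84] -/
noncomputable def comp (hF : IsFrobenioid F) (hsq : HasBiratSquares F) (f : BiratFrac F A B)
    (g : BiratFrac F B B') :
    BiratFrac F A B' :=
  compWith hF f g (someSquare hsq f g)

/-- Independence of the square: "since `β` is a monomorphism … `φ‴ ∘ α* = φ″ ∘ α″`, i.e. …
determine the
same element of `Hom^birat_C(A, C)`" (p. 84). [cite: MochizukiFrdI2008, Prop. 4.4(i) p.84] -/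
theorem compWith_rel (hF : IsFrobenioid F) (f : BiratFrac F A B) (g : BiratFrac F B B')
    (S S' : Square f g) :
    Rel (compWith hF f g S) (compWith hF f g S') := by
  obtain ⟨T, μ, μ', hμ, hμ', hT⟩ :=
    exists_common_refinement hF S.left S'.left S.left_mem S'.left_mem
  haveI : Mono g.den := g.den_mem.mono hF
  have hright : μ ≫ S.right = μ' ≫ S'.right := by
    rw [← cancel_mono g.den, Category.assoc, Category.assoc, ← S.w, ← S'.w, ← Category.assoc,
      ← Category.assoc, hT]
  refine ⟨T, μ, μ', hμ, hμ', ?_, ?_⟩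
  · change μ ≫ S.left ≫ f.den = μ' ≫ S'.left ≫ f.den
    rw [← Category.assoc, hT, Category.assoc]
  · change μ ≫ S.right ≫ g.num = μ' ≫ S'.right ≫ g.num
    rw [← Category.assoc, hright, Category.assoc]

/-- Composition respects the colimit relation in the first variable.
[cite: MochizukiFrdI2008, Prop. 4.4(i) p.84] -/
theorem comp_rel_left (hF : IsFrobenioid F) (hsq : HasBiratSquares F) {f f' : BiratFrac F A B}
    (g : BiratFrac F B B')
    (h : Rel f f') : Rel (comp hF hsq f g) (comp hF hsq f' g) := by
  obtain ⟨E, ε, ε', hε, hε', hden, hnum⟩ := h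
  let S := someSquare hsq f g
  obtain ⟨T, ν, ν', hν, hν', hT⟩ := exists_common_refinement hF S.left ε S.left_mem hε
  let S' : Square f' g :=
    { apex := T, left := ν' ≫ ε', right := ν ≫ S.right, left_mem := hν'.comp hF hε'
      w := by rw [Category.assoc, ← hnum, ← Category.assoc, ← hT, Category.assoc, S.w,
        Category.assoc] }
  change Rel (comp hF hsq f g) (compWith hF f' g (someSquare hsq f' g))
  refine Rel.trans hF ?_ (compWith_rel hF f' g S' _)
  refine ⟨T, ν, 𝟙 T, hν, isCoAngularPreStep_id hF T, ?_, ?_⟩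
  · change ν ≫ S.left ≫ f.den = 𝟙 T ≫ (ν' ≫ ε') ≫ f'.den
    rw [Category.id_comp, Category.assoc, ← hden, ← Category.assoc ν', ← hT, Category.assoc]
  · change ν ≫ S.right ≫ g.num = 𝟙 T ≫ (ν ≫ S.right) ≫ g.num
    rw [Category.id_comp, Category.assoc]

/-- Composition respects the colimit relation in the second variable.
[cite: MochizukiFrdI2008, Prop. 4.4(i) p.84] -/
theorem comp_rel_right (hF : IsFrobenioid F) (hsq : HasBiratSquares F) (f : BiratFrac F A B)
    {g g' : BiratFrac F B B'}
    (h : Rel g g') : Rel (comp hF hsq f g) (comp hF hsq f g') := by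
  obtain ⟨E, ε, ε', hε, hε', hden, hnum⟩ := h
  let S := someSquare hsq f g
  -- complete `S.right : S.apex → g.src` against the co-angular pre-step `ε : E → g.src`
  obtain ⟨T, ν, ν', hν, hT⟩ := hsq S.right ε hε
  let S' : Square f g' :=
    { apex := T, left := ν ≫ S.left, right := ν' ≫ ε', left_mem := hν.comp hF S.left_mem
      w := by rw [Category.assoc, S.w, ← Category.assoc, hT, Category.assoc, hden,
        Category.assoc] }
  change Rel (comp hF hsq f g) (compWith hF f g' (someSquare hsq f g'))
  refine Rel.trans hF ?_ (compWith_rel hF f g' S' _)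
  refine ⟨T, ν, 𝟙 T, hν, isCoAngularPreStep_id hF T, ?_, ?_⟩
  · change ν ≫ S.left ≫ f.den = 𝟙 T ≫ (ν ≫ S.left) ≫ f.den
    rw [Category.id_comp, Category.assoc]
  · change ν ≫ S.right ≫ g.num = 𝟙 T ≫ (ν' ≫ ε') ≫ g'.num
    rw [Category.id_comp, Category.assoc, ← hnum, ← Category.assoc ν', ← hT, Category.assoc]

/-! ### Unit and associativity laws up to the relation ("one verifies immediately", p. 84) -/

/-- Left unit: `(id, id_A)` then `f`. [cite: MochizukiFrdI2008, Prop. 4.4(i) p.84] -/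
theorem id_comp_rel (hF : IsFrobenioid F) (hsq : HasBiratSquares F) (f : BiratFrac F A B) :
    Rel (comp hF hsq (ofHom hF (𝟙 A)) f) f := by
  let S : Square (ofHom hF (𝟙 A)) f :=
    { apex := f.src, left := f.den, right := 𝟙 _, left_mem := f.den_mem
      w := by
        change f.den ≫ 𝟙 A = 𝟙 _ ≫ f.den
        rw [Category.comp_id, Category.id_comp] }
  refine Rel.trans hF (compWith_rel hF _ _ _ S) ?_
  refine ⟨f.src, 𝟙 _, 𝟙 _, isCoAngularPreStep_id hF _, isCoAngularPreStep_id hF _, ?_, ?_⟩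
  · change 𝟙 _ ≫ f.den ≫ 𝟙 A = 𝟙 _ ≫ f.den
    rw [Category.comp_id]
  · change 𝟙 _ ≫ 𝟙 _ ≫ f.num = 𝟙 _ ≫ f.num
    rw [Category.id_comp]

/-- Right unit: `f` then `(id, id_B)`. [cite: MochizukiFrdI2008, Prop. 4.4(i) p.84] -/
theorem comp_id_rel (hF : IsFrobenioid F) (hsq : HasBiratSquares F) (f : BiratFrac F A B) :
    Rel (comp hF hsq f (ofHom hF (𝟙 B))) f := by
  let S : Square f (ofHom hF (𝟙 B)) :=
    { apex := f.src, left := 𝟙 _, right := f.num, left_mem := isCoAngularPreStep_id hF _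
      w := by
        change 𝟙 _ ≫ f.num = f.num ≫ 𝟙 B
        rw [Category.comp_id, Category.id_comp] }
  refine Rel.trans hF (compWith_rel hF _ _ _ S) ?_
  refine ⟨f.src, 𝟙 _, 𝟙 _, isCoAngularPreStep_id hF _, isCoAngularPreStep_id hF _, ?_, ?_⟩
  · change 𝟙 _ ≫ 𝟙 _ ≫ f.den = 𝟙 _ ≫ f.den
    rw [Category.id_comp]
  · change 𝟙 _ ≫ f.num ≫ 𝟙 B = 𝟙 _ ≫ f.num
    rw [Category.comp_id]

/-- Associativity: compute both bracketings with squares through a common apex (complete the chosen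
square of `(f, g)` against that of `(g, k)`). [cite: MochizukiFrdI2008, Prop. 4.4(i) p.84] -/
theorem comp_assoc_rel (hF : IsFrobenioid F) (hsq : HasBiratSquares F) (f : BiratFrac F A B)
    (g : BiratFrac F B B') (k : BiratFrac F B' B'') :
    Rel (comp hF hsq (comp hF hsq f g) k) (comp hF hsq f (comp hF hsq g k)) := by
  let S := someSquare hsq f g
  let S' := someSquare hsq g k
  obtain ⟨Z, z, t, hz, hZ⟩ := hsq S.right S'.left S'.left_mem
  let S2 : Square (compWith hF f g S) k :=
    { apex := Z, left := z, right := t ≫ S'.right, left_mem := hz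
      w := by
        change z ≫ S.right ≫ g.num = (t ≫ S'.right) ≫ k.den
        rw [← Category.assoc, hZ, Category.assoc, S'.w, Category.assoc] }
  let S4 : Square f (compWith hF g k S') :=
    { apex := Z, left := z ≫ S.left, right := t, left_mem := hz.comp hF S.left_mem
      w := by
        change (z ≫ S.left) ≫ f.num = t ≫ S'.left ≫ g.den
        rw [Category.assoc, S.w, ← Category.assoc, hZ, Category.assoc] }
  have h1 : Rel (comp hF hsq (comp hF hsq f g) k) (compWith hF (compWith hF f g S) k S2) :=
    compWith_rel hF _ _ _ S2
  have h2 : Rel (comp hF hsq f (comp hF hsq g k)) (compWith hF f (compWith hF g k S') S4) :=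
    compWith_rel hF _ _ _ S4
  refine Rel.trans hF h1 (Rel.trans hF ?_ h2.symm)
  refine ⟨Z, 𝟙 Z, 𝟙 Z, isCoAngularPreStep_id hF Z, isCoAngularPreStep_id hF Z, ?_, ?_⟩
  · change 𝟙 Z ≫ z ≫ S.left ≫ f.den = 𝟙 Z ≫ (z ≫ S.left) ≫ f.den
    rw [Category.assoc]
  · change 𝟙 Z ≫ (t ≫ S'.right) ≫ k.num = 𝟙 Z ≫ t ≫ S'.right ≫ k.num
    rw [Category.assoc]

end BiratFrac

end PreFrobenioid

end Literature.AlgebraicGeometry.Frobenioids
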